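import Literature.Probability.LatticeModels.SahiThirdOrderCorrelation

/-!
# `NoHeavyLowerTail` (crux stmt-CriticalPhenomena-4575), Sahi programme P1: the THREE-COPY PATTERN KERNEL on the 27-point cube
# `[3]³` — definitions, trilinear expansion, and the parametrisation of its up-sets (kernel of the proof of Sahi's `C₃` on 3-D grids)

Support file (Sahi cell, seat `prim-sahi-p1`, generation 6; `--supports stmt-CriticalPhenomena-4575`).  Pure definitions and
kernel-checked lemmas; no `sorry`, no `native_decide`, standard axioms.

THE MATHEMATICS (companion files `…SahiGridThreeCheck` (certificate) and `…SahiGridThree` (the theorem)): for every product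
weight `n¹ ⊗ n² ⊗ n³ ≥ 0` on a grid `[K₁]×[K₂]×[K₃]` and all up-sets `A, B, C`, the homogeneous Sahi cubic `Z³·E₃(A,B,C)` (tree
`latticeE3`) is a polynomial in the chain weights with NONNEGATIVE coefficients; after symmetrising the three-copy expansion of
`E₃` over `S₃³` (one permutation of the copies per axis) each coefficient is a positive multiple of `sStar A* B* C*` for a
pulled-back triple of up-sets of the small cube `P3 = Fin 3 → Fin 3`:
  `sStar A B C = Σ_{β,γ,ρ ∈ S₃} h(P_{ρ0}, P_{ρ1}, P_{ρ2})`, `P_d = (d, β d, γ d)` (the `216` ordered "permutation patterns"),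
  `h(x,y,z) = 2·A(x)B(x)C(x) − A(x)B(y)C(y) − B(x)A(y)C(y) − C(x)A(y)B(y) + A(x)B(y)C(z)` (three-copy kernel of `E₃`).
THIS FILE: `ind`, `hZ`, `pt`, `sStar`; `permList` (the six permutations, for computation); the TRILINEAR EXPANSION
`sStar A B C = Σ_{x∈A, y∈B, z∈C} sStar {x} {y} {z}` (`sStar_eq_sum_single`); point indices `pidx`/`pnt`; the index-level kernel
`TI` with `TI (pidx x) (pidx y) (pidx z) = sStar {x} {y} {z}` (`TI_pidx`); and a COMPLETE parametrisation of the up-sets of `P3` by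
monotone threshold vectors (`upVecs`, 980 of them, sorted by size; `U`; `exists_upVec`). [this work]
-/

namespace Summit.CriticalPhenomena.PercolationContinuityZ3.Theorems.SahiGrid3

open Finset

/-- The small cube: points `q : Fin 3 → Fin 3` (axis `a ↦` coordinate `q a`), ordered pointwise. [this work] -/
abbrev P3 := Fin 3 → Fin 3

/-! ### The three-copy kernel and `sStar` -/

/-- Integer indicator of a finset. [this work] -/
def ind {Y : Type*} [DecidableEq Y] (S : Finset Y) (y : Y) : ℤ := if y ∈ S then 1 else 0

/-- The three-copy kernel of Sahi's `E₃` (integer form):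
`h(x,y,z) = 2·A(x)B(x)C(x) − A(x)B(y)C(y) − B(x)A(y)C(y) − C(x)A(y)B(y) + A(x)B(y)C(z)`. [this work] -/
def hZ {Y : Type*} [DecidableEq Y] (A B C : Finset Y) (x y z : Y) : ℤ :=
  2 * (ind A x * ind B x * ind C x) - ind A x * ind B y * ind C y - ind B x * ind A y * ind C y
    - ind C x * ind A y * ind B y + ind A x * ind B y * ind C z

/-- The point `P_d = (d, β d, γ d)` of the permutation pattern `(β, γ)`. [this work] -/
def pt (β γ : Equiv.Perm (Fin 3)) (d : Fin 3) : P3 := ![d, β d, γ d]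

/-- **`sStar`**: the three-copy kernel summed over the `216` ordered permutation patterns `(P_{ρ0}, P_{ρ1}, P_{ρ2})`. [this work] -/
def sStar (A B C : Finset P3) : ℤ :=
  ∑ β : Equiv.Perm (Fin 3), ∑ γ : Equiv.Perm (Fin 3), ∑ ρ : Equiv.Perm (Fin 3),
    hZ A B C (pt β γ (ρ 0)) (pt β γ (ρ 1)) (pt β γ (ρ 2))

/-- The six permutations of `Fin 3`, as a list. [this work] -/
def permList : List (Equiv.Perm (Fin 3)) :=
  [1, Equiv.swap 0 1, Equiv.swap 0 2, Equiv.swap 1 2, (Equiv.swap 0 1).trans (Equiv.swap 0 2),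
    (Equiv.swap 0 2).trans (Equiv.swap 0 1)]

/-- `permList` has no duplicates. [this work] -/
theorem permList_nodup : permList.Nodup := by decide

/-- `permList` is all of `S₃`. [this work] -/
theorem mem_permList (σ : Equiv.Perm (Fin 3)) : σ ∈ permList := by revert σ; decide

/-- Sums over `S₃` are list sums over `permList`. [this work] -/
theorem sum_perm_eq_permList (f : Equiv.Perm (Fin 3) → ℤ) : ∑ σ, f σ = (permList.map f).sum := by
  rw [← List.sum_toFinset _ permList_nodup]
  exact Finset.sum_congr (by ext σ; simp [mem_permList σ]) fun _ _ => rfl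

/-! ### Trilinear expansion -/

/-- `1_A(t) = Σ_{a ∈ A} 1_{{a}}(t)`. [this work] -/
theorem ind_eq_sum_single {Y : Type*} [DecidableEq Y] (S : Finset Y) (t : Y) :
    ind S t = ∑ a ∈ S, ind {a} t := by
  unfold ind
  simp_rw [Finset.mem_singleton]
  rw [Finset.sum_ite_eq]

/-- Product of three indicator sums, expanded. [this work] -/
theorem ind_mul3_eq_sum (A B C : Finset P3) (s t u : P3) :
    ind A s * ind B t * ind C u = ∑ a ∈ A, ∑ b ∈ B, ∑ c ∈ C, ind {a} s * ind {b} t * ind {c} u := by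
  rw [ind_eq_sum_single A s, ind_eq_sum_single B t, ind_eq_sum_single C u, Finset.sum_mul_sum, Finset.sum_mul]
  refine Finset.sum_congr rfl fun a _ => ?_
  rw [Finset.sum_mul]
  refine Finset.sum_congr rfl fun b _ => ?_
  rw [Finset.mul_sum]

/-- The kernel is trilinear in the three indicator functions. [this work] -/
theorem hZ_eq_sum_single (A B C : Finset P3) (x y z : P3) :
    hZ A B C x y z = ∑ a ∈ A, ∑ b ∈ B, ∑ c ∈ C, hZ {a} {b} {c} x y z := by
  have k1 := ind_mul3_eq_sum A B C x x x
  have k2 := ind_mul3_eq_sum A B C x y y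
  have k3 : ind B x * ind A y * ind C y = ∑ a ∈ A, ∑ b ∈ B, ∑ c ∈ C, ind {b} x * ind {a} y * ind {c} y := by
    rw [show ind B x * ind A y * ind C y = ind A y * ind B x * ind C y by ring, ind_mul3_eq_sum]
    exact Finset.sum_congr rfl fun a _ => Finset.sum_congr rfl fun b _ => Finset.sum_congr rfl fun c _ => by ring
  have k4 : ind C x * ind A y * ind B y = ∑ a ∈ A, ∑ b ∈ B, ∑ c ∈ C, ind {c} x * ind {a} y * ind {b} y := by
    rw [show ind C x * ind A y * ind B y = ind A y * ind B y * ind C x by ring, ind_mul3_eq_sum]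
    exact Finset.sum_congr rfl fun a _ => Finset.sum_congr rfl fun b _ => Finset.sum_congr rfl fun c _ => by ring
  have k5 := ind_mul3_eq_sum A B C x y z
  unfold hZ
  rw [k1, k2, k3, k4, k5]
  simp only [Finset.mul_sum, ← Finset.sum_sub_distrib, ← Finset.sum_add_distrib]

/-- Moving a finset sum past the three pattern sums. [this work] -/
theorem sum_perm3_comm (S : Finset P3) (G : Equiv.Perm (Fin 3) → Equiv.Perm (Fin 3) → Equiv.Perm (Fin 3) → P3 → ℤ) :
    (∑ β : Equiv.Perm (Fin 3), ∑ γ : Equiv.Perm (Fin 3), ∑ ρ : Equiv.Perm (Fin 3), ∑ x ∈ S, G β γ ρ x) =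
      ∑ x ∈ S, ∑ β : Equiv.Perm (Fin 3), ∑ γ : Equiv.Perm (Fin 3), ∑ ρ : Equiv.Perm (Fin 3), G β γ ρ x := by
  have h1 : (∑ β : Equiv.Perm (Fin 3), ∑ γ : Equiv.Perm (Fin 3), ∑ ρ : Equiv.Perm (Fin 3), ∑ x ∈ S, G β γ ρ x) =
      ∑ β : Equiv.Perm (Fin 3), ∑ γ : Equiv.Perm (Fin 3), ∑ x ∈ S, ∑ ρ : Equiv.Perm (Fin 3), G β γ ρ x :=
    Finset.sum_congr rfl fun β _ => Finset.sum_congr rfl fun γ _ => Finset.sum_comm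
  have h2 : (∑ β : Equiv.Perm (Fin 3), ∑ γ : Equiv.Perm (Fin 3), ∑ x ∈ S, ∑ ρ : Equiv.Perm (Fin 3), G β γ ρ x) =
      ∑ β : Equiv.Perm (Fin 3), ∑ x ∈ S, ∑ γ : Equiv.Perm (Fin 3), ∑ ρ : Equiv.Perm (Fin 3), G β γ ρ x :=
    Finset.sum_congr rfl fun β _ => Finset.sum_comm
  rw [h1, h2]
  exact Finset.sum_comm

/-- **Trilinear expansion**: `sStar A B C = Σ_{x ∈ A} Σ_{y ∈ B} Σ_{z ∈ C} sStar {x} {y} {z}`. [this work] -/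
theorem sStar_eq_sum_single (A B C : Finset P3) :
    sStar A B C = ∑ x ∈ A, ∑ y ∈ B, ∑ z ∈ C, sStar {x} {y} {z} := by
  unfold sStar
  simp_rw [hZ_eq_sum_single A B C]
  rw [sum_perm3_comm A]
  refine Finset.sum_congr rfl fun x _ => ?_
  rw [sum_perm3_comm B]
  refine Finset.sum_congr rfl fun y _ => ?_
  rw [sum_perm3_comm C]

/-! ### Point indices and the index-level kernel -/

/-- Index `9 q₀ + 3 q₁ + q₂ < 27` of a point. [this work] -/
def pidx (q : P3) : ℕ := 9 * (q 0 : ℕ) + 3 * (q 1 : ℕ) + (q 2 : ℕ)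

/-- `pidx < 27`. [this work] -/
theorem pidx_lt (q : P3) : pidx q < 27 := by
  have h0 := (q 0).isLt; have h1 := (q 1).isLt; have h2 := (q 2).isLt; unfold pidx; omega

/-- The point with a given index. [this work] -/
def pnt (n : ℕ) : P3 := ![⟨n / 9 % 3, Nat.mod_lt _ (by omega)⟩, ⟨n / 3 % 3, Nat.mod_lt _ (by omega)⟩,
  ⟨n % 3, Nat.mod_lt _ (by omega)⟩]

/-- `pnt ∘ pidx = id`. [this work] -/
theorem pnt_pidx (q : P3) : pnt (pidx q) = q := by
  revert q; decide

/-- `pidx` is injective. [this work] -/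
theorem pidx_injective : Function.Injective pidx := fun q q' h => by
  rw [← pnt_pidx q, ← pnt_pidx q', h]

/-- `pidx ∘ pnt = id` below `27`. [this work] -/
theorem pidx_pnt {n : ℕ} (hn : n < 27) : pidx (pnt n) = n := by
  unfold pidx pnt
  simp only [Matrix.cons_val_zero, Matrix.cons_val_one, Matrix.cons_val]
  omega

/-- The `216` ordered permutation patterns as index triples. [this work] -/
def pat216 : List (ℕ × ℕ × ℕ) :=
  permList.flatMap fun β => permList.flatMap fun γ => permList.map fun ρ =>
    (pidx (pt β γ (ρ 0)), pidx (pt β γ (ρ 1)), pidx (pt β γ (ρ 2)))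

/-- The kernel for singletons `{x},{y},{z}` at a pattern, on indices (`[·]` = Nat equality). [this work] -/
def hI (x y z : ℕ) (p : ℕ × ℕ × ℕ) : ℤ :=
  let e := fun (s t : ℕ) => (if s = t then (1 : ℤ) else 0)
  2 * (e p.1 x * e p.1 y * e p.1 z) - e p.1 x * e p.2.1 y * e p.2.1 z - e p.1 y * e p.2.1 x * e p.2.1 z
    - e p.1 z * e p.2.1 x * e p.2.1 y + e p.1 x * e p.2.1 y * e p.2.2 z

/-- **`TI`**: the trilinear coefficient `sStar {x} {y} {z}` computed on indices. [this work] -/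
def TI (x y z : ℕ) : ℤ := (pat216.map (hI x y z)).sum

/-- Indicator of a singleton on indices. [this work] -/
theorem ind_single_eq (a t : P3) : ind {a} t = if pidx t = pidx a then 1 else 0 := by
  unfold ind
  by_cases h : t = a
  · subst h; simp
  · have h1 : t ∉ ({a} : Finset P3) := by rwa [Finset.mem_singleton]
    have h2 : pidx t ≠ pidx a := fun e => h (pidx_injective e)
    simp [h1, h2]

/-- Nested list sum over a `flatMap`. [folklore] -/
theorem sum_map_flatMap {ι κ : Type*} (f : κ → ℤ) (g : ι → List κ) : ∀ l : List ι,
    ((l.flatMap g).map f).sum = (l.map fun b => ((g b).map f).sum).sum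
  | [] => by simp
  | b :: l => by
    rw [List.flatMap_cons, List.map_append, List.sum_append, sum_map_flatMap f g l, List.map_cons, List.sum_cons]

/-- **`TI` is `sStar` on singletons.** [this work] -/
theorem TI_pidx (a b c : P3) : TI (pidx a) (pidx b) (pidx c) = sStar {a} {b} {c} := by
  unfold TI pat216 sStar
  rw [sum_map_flatMap, sum_perm_eq_permList]
  apply congrArg List.sum; apply List.map_congr_left; intro β _
  rw [sum_map_flatMap, sum_perm_eq_permList]
  apply congrArg List.sum; apply List.map_congr_left; intro γ _
  rw [List.map_map, sum_perm_eq_permList]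
  apply congrArg List.sum; apply List.map_congr_left; intro ρ _
  show hI (pidx a) (pidx b) (pidx c) (pidx (pt β γ (ρ 0)), pidx (pt β γ (ρ 1)), pidx (pt β γ (ρ 2))) = _
  unfold hI hZ
  simp only [ind_single_eq]

/-! ### Up-sets of the small cube, parametrised by monotone threshold vectors -/

/-- All lists of length `n` with entries in `{0,1,2,3}`. [this work] -/
def vecs : ℕ → List (List ℕ)
  | 0 => [[]]
  | n + 1 => (vecs n).flatMap fun v => [0, 1, 2, 3].map fun x => x :: v

/-- Completeness of `vecs`. [this work] -/
theorem mem_vecs : ∀ (v : List ℕ), (∀ x ∈ v, x ≤ 3) → v ∈ vecs v.length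
  | [], _ => by simp [vecs]
  | x :: v, h => by
    rw [List.length_cons, vecs, List.mem_flatMap]
    refine ⟨v, mem_vecs v fun y hy => h y (List.mem_cons_of_mem _ hy), List.mem_map.2 ⟨x, ?_, rfl⟩⟩
    have hx := h x List.mem_cons_self
    interval_cases x <;> simp

/-- Threshold of a vector at `(a,b)`: entry `3a + b`. [this work] -/
def thr (v : List ℕ) (a b : Fin 3) : ℕ := v.getD (3 * (a : ℕ) + b) 0

/-- Boolean monotonicity test of a threshold vector. [this work] -/
def isMonoV (v : List ℕ) : Bool :=
  decide (∀ a b a' b' : Fin 3, a ≤ a' → b ≤ b' → thr v a b ≤ thr v a' b')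

/-- The monotone threshold vectors (980 of them), sorted by total (= size of the up-set). [this work] -/
def upVecs : List (List ℕ) := ((vecs 9).filter isMonoV).mergeSort fun v w => v.sum ≤ w.sum

/-- The up-set of the small cube with threshold vector `v`: `{q | 3 − thr v (q 0) (q 1) ≤ q 2}`. [this work] -/
def U (v : List ℕ) : Finset P3 := univ.filter fun q => 3 - thr v (q 0) (q 1) ≤ (q 2 : ℕ)

/-- An up-set of `Fin 3` is the final segment of length its cardinality (kernel `decide`). [this work] -/
theorem mem_iff_card_of_upper : ∀ F : Finset (Fin 3), (∀ c c' : Fin 3, c ≤ c' → c ∈ F → c' ∈ F) →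
    ∀ c : Fin 3, c ∈ F ↔ 3 - F.card ≤ (c : ℕ) := by
  decide

/-- A point of the small cube in vector notation. [this work] -/
theorem vec_eq (q : P3) : ![q 0, q 1, q 2] = q := by
  funext i; fin_cases i <;> rfl

/-- The fibre of a finset of the small cube over `(a,b)`. [this work] -/
def fib (A : Finset P3) (a b : Fin 3) : Finset (Fin 3) := univ.filter fun c => (![a, b, c] : P3) ∈ A

/-- The threshold vector of a finset of the small cube: fibre cardinalities. [this work] -/
def vecOf (A : Finset P3) : List ℕ :=
  List.ofFn fun k : Fin 9 => (fib A ⟨k / 3, by omega⟩ ⟨k % 3, by omega⟩).card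

/-- `thr (vecOf A) a b` is the fibre cardinality. [this work] -/
theorem thr_vecOf (A : Finset P3) (a b : Fin 3) : thr (vecOf A) a b = (fib A a b).card := by
  have ha := a.isLt; have hb := b.isLt
  have h : 3 * (a : ℕ) + b < 9 := by omega
  have hlen : 3 * (a : ℕ) + b < (vecOf A).length := by unfold vecOf; rw [List.length_ofFn]; exact h
  unfold thr
  rw [List.getD_eq_getElem?_getD, List.getElem?_eq_getElem hlen, Option.getD_some]
  unfold vecOf
  rw [List.getElem_ofFn]
  have e1 : (⟨(3 * (a : ℕ) + b) / 3, by omega⟩ : Fin 3) = a := Fin.ext (by simp only; omega)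
  have e2 : (⟨(3 * (a : ℕ) + b) % 3, by omega⟩ : Fin 3) = b := Fin.ext (by simp only; omega)
  simp only [e1, e2]

/-- Fibre cardinalities are at most `3`. [this work] -/
theorem card_fib_le (A : Finset P3) (a b : Fin 3) : (fib A a b).card ≤ 3 :=
  (card_le_univ _).trans (by rw [Fintype.card_fin])

/-- **Completeness of the parametrisation**: every up-set of the small cube is `U v` for some `v ∈ upVecs`. [this work] -/
theorem exists_upVec {A : Finset P3} (hA : IsUpperSet (A : Set P3)) : ∃ v ∈ upVecs, U v = A := by
  refine ⟨vecOf A, ?_, ?_⟩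
  · unfold upVecs
    rw [List.mem_mergeSort, List.mem_filter]
    refine ⟨?_, ?_⟩
    · have hlen : (vecOf A).length = 9 := by unfold vecOf; rw [List.length_ofFn]
      rw [← hlen]
      refine mem_vecs _ fun x hx => ?_
      unfold vecOf at hx
      rw [List.mem_ofFn] at hx
      obtain ⟨k, rfl⟩ := hx
      exact card_fib_le A _ _
    · unfold isMonoV
      rw [decide_eq_true_eq]
      intro a b a' b' ha hb
      rw [thr_vecOf, thr_vecOf]
      refine card_le_card fun c hc => ?_
      unfold fib at hc ⊢
      rw [mem_filter] at hc ⊢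
      refine ⟨mem_univ _, hA (show (![a, b, c] : P3) ≤ ![a', b', c] from ?_) hc.2⟩
      intro i; fin_cases i
      · exact ha
      · exact hb
      · exact le_rfl
  · ext q
    unfold U
    rw [mem_filter, thr_vecOf]
    have hup : ∀ c c' : Fin 3, c ≤ c' → c ∈ fib A (q 0) (q 1) → c' ∈ fib A (q 0) (q 1) := by
      intro c c' hcc' hc
      unfold fib at hc ⊢
      rw [mem_filter] at hc ⊢
      refine ⟨mem_univ _, hA (show (![q 0, q 1, c] : P3) ≤ ![q 0, q 1, c'] from ?_) hc.2⟩
      intro i; fin_cases i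
      · exact le_rfl
      · exact le_rfl
      · exact hcc'
    have key := mem_iff_card_of_upper (fib A (q 0) (q 1)) hup (q 2)
    have hmem : q 2 ∈ fib A (q 0) (q 1) ↔ q ∈ A := by
      unfold fib; rw [mem_filter, vec_eq]; exact ⟨fun h => h.2, fun h => ⟨mem_univ _, h⟩⟩
    rw [← hmem, key]
    exact ⟨fun h => h.2, fun h => ⟨mem_univ _, h⟩⟩

end Summit.CriticalPhenomena.PercolationContinuityZ3.Theorems.SahiGrid3
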